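import Summits.Schanuel.Schanuel.Theorems.RootDecomp1KGeneric14

/-!
# RootDecomp1K — «GENERIC CELLS», part 15: FINITE EXPONENTIAL ORDER — Piece CF at order 3: `cylinderFunnel_false_ord`, `cylinderFunnel_ord`

Provenance: ROOT DECOMPOSITION CELL decomp-schanuel (D-0178), lens 6 «barrier-complement carving»,
gen 13, Stage E «FINITE ORDER»; source `ORD.lean` (lens publication dir `decomp-schanuel-lens-6/g13/addendum/`).
Supports `stmt-Schanuel-33363` (A₄ʰ) AND carves item `stmt-Schanuel-33364` (A₄ᵈ `FiniteOrderLiouvilleSchanuel`):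
the pieces KS and CF of parts 05–11 only ever use ONE good rational approximation of the ratio `ρ`, so they
hold for reals of a FIXED exponential Liouville order — hyper-Liouville or not — and NW96 Thm 1 closes the
cell as soon as that order exceeds the exponent of its pair measure.  Sorry-free; standard axioms; nothing
here proves Schanuel (rung 0).

Contents: §5 `cf_torsion_endgame_irr` (part 03's endgame for an irrational ratio), `cylinderFunnel_false_ord`
(the proof of `cylinderFunnel_false`, part 07, verbatim at exponential order 3), `cylinderFunnel_ord`.
-/

noncomputable section

open Complex Polynomial

namespace Summit.Schanuel.Schanuel.Theorems.RootDecomp1KGeneric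

open Summit.Schanuel.Schanuel.Theorems.RootDecomp1KHyper
open Summit.Schanuel.Schanuel.Theorems.RootDecomp1KHyper.HyperCell

/-! ## ORD 5. Piece CF at finite exponential order -/

/-- The torsion endgame of CF (part 03 `cf_torsion_endgame`) for an IRRATIONAL ratio: if `u ≠ 0` and both
`e^u`, `e^{ρu}` are limits of `N`-th roots of unity then `ρ ∈ ℚ`. -/
theorem cf_torsion_endgame_irr {u : ℂ} (hu0 : u ≠ 0) {ρ : ℝ} (hρ : Irrational ρ) {N : ℕ} (hN : 0 < N)
    (hy : ∀ ε : ℝ, 0 < ε → ∃ w : ℂ, w ^ N = 1 ∧ ‖cexp u - w‖ < ε)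
    (ht : ∀ ε : ℝ, 0 < ε → ∃ w : ℂ, w ^ N = 1 ∧ ‖cexp (u * ρ) - w‖ < ε) : False := by
  obtain ⟨r, hr⟩ := exists_rat_mul_twoPiI_of_exp_pow_eq_one hN (pow_eq_one_of_forall_close hN hy)
  obtain ⟨s, hs⟩ := exists_rat_mul_twoPiI_of_exp_pow_eq_one hN (pow_eq_one_of_forall_close hN ht)
  have h2pi : (2 * Real.pi * I : ℂ) ≠ 0 := by
    have : (Real.pi : ℂ) ≠ 0 := by exact_mod_cast Real.pi_ne_zero
    simp [this, I_ne_zero]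
  have hr0 : (r : ℂ) ≠ 0 := by
    rintro h0
    apply hu0
    rw [hr, h0, zero_mul]
  have hρeq : (ρ : ℂ) = (s : ℂ) / (r : ℂ) := by
    have h1 : (r : ℂ) * (2 * Real.pi * I) * (ρ : ℂ) = (s : ℂ) * (2 * Real.pi * I) := by
      rw [← hr, ← hs]
    field_simp
    have := mul_right_cancel₀ h2pi (by
      calc (ρ : ℂ) * (r : ℂ) * (2 * Real.pi * I) = (r : ℂ) * (2 * Real.pi * I) * (ρ : ℂ) := by ring
        _ = (s : ℂ) * (2 * Real.pi * I) := h1)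
    linear_combination this
  have hρrat : ρ = ((s / r : ℚ) : ℝ) := by
    have : ((ρ : ℝ) : ℂ) = (((s / r : ℚ) : ℝ) : ℂ) := by
      rw [hρeq]; push_cast; rfl
    exact_mod_cast this
  exact hρ ⟨s / r, hρrat.symm⟩

set_option maxHeartbeats 1600000 in
/-- **Piece CF at finite exponential order (kernel, hypothesis-free).**  For `u ≠ 0` and a positive real
`ρ` of exponential Liouville order `3` (hyper-Liouville or NOT), the pairs `(ρ, e^u)` and `(ρ, e^{uρ})` are not
BOTH algebraically dependent over `ℚ` — the proof of `cylinderFunnel_false` (part 07) verbatim, which only ever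
used ONE approximation `|ρ − p/q| < exp(−q³) ≤ q^{−Ψq}`. -/
theorem cylinderFunnel_false_ord {u : ℂ} (hu0 : u ≠ 0) {ρ : ℝ} (hρ : LiouvilleOrder 3 ρ) (hρ0 : 0 < ρ)
    (hdepA : ¬ AlgebraicIndependent ℚ ![(ρ : ℂ), cexp u])
    (hdepB : ¬ AlgebraicIndependent ℚ ![(ρ : ℂ), cexp (u * ρ)]) : False := by
  have hw0 : cexp u ≠ 0 := Complex.exp_ne_zero _
  have hw'0 : cexp (u * ρ) ≠ 0 := Complex.exp_ne_zero _
  have hwpos : 0 < ‖cexp u‖ := norm_pos_iff.mpr hw0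
  have hw'pos : 0 < ‖cexp (u * ρ)‖ := norm_pos_iff.mpr hw'0
  have hρt : Transcendental ℚ (ρ : ℂ) := transcendental_ofReal_of_liouville (hρ.liouville le_rfl)
  obtain ⟨KA, GA, hGAK, hrelA⟩ := exists_int_relation hρt hdepA
  obtain ⟨KB, GB, hGBK, hrelB⟩ := exists_int_relation hρt hdepB
  have hKA : 0 < KA := relation_degree_pos hρt hGAK hrelA
  have hKB : 0 < KB := relation_degree_pos hρt hGBK hrelB
  -- degrees, lengths, Lipschitz constants
  obtain ⟨DA, hDAdef⟩ : ∃ D : ℕ, D = Finset.univ.sup fun k => (GA k).natDegree := ⟨_, rfl⟩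
  obtain ⟨DB, hDBdef⟩ : ∃ D : ℕ, D = Finset.univ.sup fun k => (GB k).natDegree := ⟨_, rfl⟩
  have hDA : ∀ k, (GA k).natDegree ≤ DA := fun k => by
    rw [hDAdef]; exact Finset.le_sup (f := fun k => (GA k).natDegree) (Finset.mem_univ k)
  have hDB : ∀ k, (GB k).natDegree ≤ DB := fun k => by
    rw [hDBdef]; exact Finset.le_sup (f := fun k => (GB k).natDegree) (Finset.mem_univ k)
  obtain ⟨ΛA, hΛA1, hΛA⟩ := exists_lipschitz_at (sliceAt GA (cexp u)) (ρ : ℂ)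
  obtain ⟨ΛB, hΛB1, hΛB⟩ := exists_lipschitz_at (sliceAt GB (cexp (u * ρ))) (ρ : ℂ)
  have hLA1 : 1 ≤ relLen GA := one_le_relLen GA hGAK
  have hLB1 : 1 ≤ relLen GB := one_le_relLen GB hGBK
  -- Kummer torsion: the constant η
  obtain ⟨η, hη, hKT⟩ := kummer_torsion KA KB
  obtain ⟨κ, hκdef⟩ : ∃ κ : ℕ, κ = KA * KB := ⟨_, rfl⟩
  have hκ1 : 1 ≤ κ := by
    rw [hκdef]; exact Nat.one_le_iff_ne_zero.mpr (Nat.mul_ne_zero hKA.ne' hKB.ne')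
  have hN : 0 < torsionExponent (KA * KB) := Nat.factorial_pos _
  -- exponents of the budget
  obtain ⟨c₀, hc₀⟩ : ∃ c : ℕ, c = ⌈ρ⌉₊ + 2 := ⟨_, rfl⟩
  obtain ⟨E, hE⟩ : ∃ E : ℕ, E = 2 * (DA + DB) + 3 := ⟨_, rfl⟩
  obtain ⟨Φ₁, hΦ₁⟩ : ∃ F : ℕ, F = 4 * E * c₀ * κ := ⟨_, rfl⟩
  obtain ⟨Φ, hΦ⟩ : ∃ F : ℕ, F = (c₀ + 2) + Φ₁ + 1 := ⟨_, rfl⟩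
  obtain ⟨Ψ, hΨ⟩ : ∃ P : ℕ, P = Φ * (KA + KB) + E + 1 := ⟨_, rfl⟩
  have hc₀2 : 2 ≤ c₀ := by rw [hc₀]; omega
  have hE3 : 3 ≤ E := by rw [hE]; omega
  have hDAE : DA ≤ E := by rw [hE]; omega
  have hDBE : DB ≤ E := by rw [hE]; omega
  have hΦΨ : Φ ≤ Ψ := by
    rw [hΨ]
    have : Φ ≤ Φ * (KA + KB) := Nat.le_mul_of_pos_right Φ (by omega)
    omega
  have hΦ1 : 1 ≤ Φ := by rw [hΦ]; omega
  have hΨ2 : 2 ≤ Ψ := by rw [hΨ]; omega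
  obtain ⟨q₂, hq₂⟩ := exists_pow_lt_const_pow (E * κ) (one_lt_two (α := ℝ))
  obtain ⟨q₃, hq₃⟩ := exists_pow_lt_const_pow (E * κ) (show (1 : ℝ) < 1 + η by linarith)
  -- THE CLAIM: both exponentials are limits of N-th roots of unity, N = torsionExponent (KA·KB)
  have claim : ∀ ε : ℝ, 0 < ε → ∃ y γ : ℂ, y ^ torsionExponent (KA * KB) = 1 ∧
      γ ^ torsionExponent (KA * KB) = 1 ∧ ‖cexp u - y‖ < ε ∧ ‖cexp (u * ρ) - γ‖ < ε := by
    intro ε hε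
    -- threshold: a SUM of the individual thresholds (each summand is then `≤ q` linearly)
    obtain ⟨q₀, hq₀def⟩ : ∃ q₀ : ℕ, q₀ = 3 + Ψ + q₂ + q₃ + denBound (GA (Fin.last KA)) +
        denBound (GB (Fin.last KB)) + (KA + 1) + (KB + 1) + ⌈relLen GA⌉₊ + ⌈relLen GB⌉₊ + ⌈ΛA⌉₊ +
        ⌈ΛB⌉₊ + c₀ + ⌈Real.exp ‖u‖⌉₊ + ⌈2 * ‖u‖⌉₊ + ⌈‖cexp u‖ + 1⌉₊ + ⌈‖cexp (u * ρ)‖ + 1⌉₊ +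
        (⌈1 / ‖cexp u‖⌉₊ + 1) + (⌈1 / ‖cexp (u * ρ)‖⌉₊ + 1) + (⌈1 / ρ⌉₊ + 1) + (⌈1 / ε⌉₊ + 1) :=
      ⟨_, rfl⟩
    obtain ⟨r, hden, hρr, hΔ⟩ := hρ q₀
    have hq3 : 3 ≤ r.den := by omega
    have hΨq : Ψ ≤ r.den := by omega
    have hq₂q : q₂ ≤ r.den := by omega
    have hq₃q : q₃ ≤ r.den := by omega
    have hdenA : denBound (GA (Fin.last KA)) ≤ r.den := by omega
    have hdenB : denBound (GB (Fin.last KB)) ≤ r.den := by omega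
    have hKAq : KA + 1 ≤ r.den := by omega
    have hKBq : KB + 1 ≤ r.den := by omega
    have hLAq : ⌈relLen GA⌉₊ ≤ r.den := by omega
    have hLBq : ⌈relLen GB⌉₊ ≤ r.den := by omega
    have hΛAq : ⌈ΛA⌉₊ ≤ r.den := by omega
    have hΛBq : ⌈ΛB⌉₊ ≤ r.den := by omega
    have hc₀q : c₀ ≤ r.den := by omega
    have hexpq : ⌈Real.exp ‖u‖⌉₊ ≤ r.den := by omega
    have huq : ⌈2 * ‖u‖⌉₊ ≤ r.den := by omega
    have hwq : ⌈‖cexp u‖ + 1⌉₊ ≤ r.den := by omega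
    have hw'q : ⌈‖cexp (u * ρ)‖ + 1⌉₊ ≤ r.den := by omega
    have hiwq : ⌈1 / ‖cexp u‖⌉₊ < r.den := by omega
    have hiw'q : ⌈1 / ‖cexp (u * ρ)‖⌉₊ < r.den := by omega
    have hiρq : ⌈1 / ρ⌉₊ < r.den := by omega
    have hiεq : ⌈1 / ε⌉₊ < r.den := by omega
    clear hq₀def
    -- the integer q and the real number Q = q
    set q : ℕ := r.den with hqdef
    have hqpos : 0 < q := by omega
    have hq2 : 2 ≤ q := by omega
    obtain ⟨Q, hQdef⟩ : ∃ Q : ℝ, Q = (q : ℝ) := ⟨_, rfl⟩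
    have hQ1 : (1 : ℝ) ≤ Q := by rw [hQdef]; exact_mod_cast hqpos
    have hQ0 : (0 : ℝ) < Q := by linarith
    have hQ2 : (2 : ℝ) ≤ Q := by rw [hQdef]; exact_mod_cast hq2
    have hQ3 : (3 : ℝ) ≤ Q := by rw [hQdef]; exact_mod_cast hq3
    have hLAQ : relLen GA ≤ Q := by rw [hQdef]; exact Nat.ceil_le.mp hLAq
    have hLBQ : relLen GB ≤ Q := by rw [hQdef]; exact Nat.ceil_le.mp hLBq
    have hΛAQ : ΛA ≤ Q := by rw [hQdef]; exact Nat.ceil_le.mp hΛAq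
    have hΛBQ : ΛB ≤ Q := by rw [hQdef]; exact Nat.ceil_le.mp hΛBq
    have hc₀Q : (c₀ : ℝ) ≤ Q := by rw [hQdef]; exact_mod_cast hc₀q
    have hexpQ : Real.exp ‖u‖ ≤ Q := by rw [hQdef]; exact Nat.ceil_le.mp hexpq
    have huQ : 2 * ‖u‖ ≤ Q := by rw [hQdef]; exact Nat.ceil_le.mp huq
    have huQ' : ‖u‖ ≤ Q := by linarith [norm_nonneg u]
    have hwQ : ‖cexp u‖ + 1 ≤ Q := by rw [hQdef]; exact Nat.ceil_le.mp hwq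
    have hw'Q : ‖cexp (u * ρ)‖ + 1 ≤ Q := by rw [hQdef]; exact Nat.ceil_le.mp hw'q
    have hiwQ : Q⁻¹ < ‖cexp u‖ :=
      inv_lt_of_one_div_lt hwpos hQ0 (by rw [hQdef]; exact Nat.lt_of_ceil_lt hiwq)
    have hiw'Q : Q⁻¹ < ‖cexp (u * ρ)‖ :=
      inv_lt_of_one_div_lt hw'pos hQ0 (by rw [hQdef]; exact Nat.lt_of_ceil_lt hiw'q)
    have hiρQ : Q⁻¹ < ρ := inv_lt_of_one_div_lt hρ0 hQ0 (by rw [hQdef]; exact Nat.lt_of_ceil_lt hiρq)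
    have hiεQ : Q⁻¹ < ε := inv_lt_of_one_div_lt hε hQ0 (by rw [hQdef]; exact Nat.lt_of_ceil_lt hiεq)
    -- the approximation Δ = |ρ − r| and its hyper-smallness
    obtain ⟨Δ, hΔdef⟩ : ∃ Δ : ℝ, Δ = |ρ - r| := ⟨_, rfl⟩
    rw [← hΔdef] at hΔ
    have hΔpos : 0 < Δ := by rw [hΔdef]; exact abs_pos.mpr (sub_ne_zero.mpr hρr)
    have hΔΨ : Δ < (Q ^ (Ψ * q))⁻¹ := by
      calc Δ < Real.exp (-((q : ℝ) ^ 3)) := hΔ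
        _ = (Real.exp ((q : ℝ) ^ 3))⁻¹ := Real.exp_neg _
        _ ≤ (Q ^ (Ψ * q))⁻¹ := by
            refine inv_anti₀ (pow_pos hQ0 _) ?_
            rw [hQdef]; exact pow_mul_le_exp_pow hΨq le_rfl
    -- θ := 1/Q^{Φ q}, the common size of the three small quantities
    obtain ⟨θ, hθdef⟩ : ∃ θ : ℝ, θ = (Q ^ (Φ * q))⁻¹ := ⟨_, rfl⟩
    have hθpos : 0 < θ := by rw [hθdef]; positivity
    have hθQ : θ ≤ Q⁻¹ := by
      rw [hθdef]
      have := inv_pow_le_inv_pow hQ1 (one_le_mul hΦ1 hqpos)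
      rwa [pow_one] at this
    have hθ1 : θ ≤ 1 := hθQ.trans (inv_le_one_of_one_le₀ hQ1)
    have hθw : θ < ‖cexp u‖ := lt_of_le_of_lt hθQ hiwQ
    have hθw' : θ < ‖cexp (u * ρ)‖ := lt_of_le_of_lt hθQ hiw'Q
    have hθε : θ < ε := lt_of_le_of_lt hθQ hiεQ
    have hΔθ : Δ < θ := by
      rw [hθdef]
      exact lt_of_lt_of_le hΔΨ (inv_pow_le_inv_pow hQ1 (Nat.mul_le_mul_right q hΦΨ))
    have hΔQ : Δ < Q⁻¹ := lt_of_lt_of_le hΔθ hθQ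
    have hΔ1 : Δ ≤ 1 := (hΔθ.le).trans hθ1
    have hΔ1' : |ρ - r| ≤ 1 := by rw [← hΔdef]; exact hΔ1
    have hΔρ : Δ < ρ := lt_trans hΔQ hiρQ
    -- r > 0; p = num r ∈ ℕ, coprime to q
    have hr0 : (0 : ℝ) < r := by
      have h := (abs_lt.mp (show |ρ - r| < ρ by rw [← hΔdef]; exact hΔρ)).2
      linarith
    have hnum : 0 < r.num := Rat.num_pos.mpr (by exact_mod_cast hr0)
    obtain ⟨p, hpdef⟩ : ∃ p : ℕ, p = r.num.natAbs := ⟨_, rfl⟩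
    have hpZ : (p : ℤ) = r.num := by rw [hpdef]; exact Int.natAbs_of_nonneg hnum.le
    have hcop : Nat.Coprime p q := by rw [hpdef]; exact r.reduced
    have hrpq : (r : ℝ) = (p : ℝ) / Q := by
      rw [hQdef, Rat.cast_def, ← hpZ]; push_cast; rfl
    have habsnum : |((r.num : ℤ) : ℝ)| = (p : ℝ) := by
      rw [← hpZ]; push_cast; exact abs_of_nonneg (Nat.cast_nonneg p)
    -- p + q ≤ c₀ q
    have hr1 : (r : ℝ) ≤ ρ + 1 := by
      have h := (abs_le.mp hΔ1').1
      linarith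
    have hpQ : (p : ℝ) ≤ (ρ + 1) * Q := by
      rw [hrpq, div_le_iff₀ hQ0] at hr1; exact hr1
    have hpq_nat : p + q ≤ c₀ * q := by
      have h1 : (p : ℝ) ≤ ((⌈ρ⌉₊ : ℝ) + 1) * Q := hpQ.trans (by gcongr; exact Nat.le_ceil ρ)
      have h2 : p ≤ (⌈ρ⌉₊ + 1) * q := by rw [hQdef] at h1; exact_mod_cast h1
      rw [hc₀]
      calc p + q ≤ (⌈ρ⌉₊ + 1) * q + q := by omega
        _ = (⌈ρ⌉₊ + 2) * q := by ring
    have hp_c₀q : p ≤ c₀ * q := le_trans (Nat.le_add_right p q) hpq_nat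
    have hpQQ : (p : ℝ) + Q ≤ Q * Q := by
      have h1 : ((p + q : ℕ) : ℝ) ≤ ((c₀ * q : ℕ) : ℝ) := by exact_mod_cast hpq_nat
      push_cast at h1
      rw [hQdef]
      exact h1.trans (by rw [← hQdef]; exact mul_le_mul_of_nonneg_right hc₀Q hQ0.le)
    -- |ρ q − p| = Q Δ
    have hρqp : |ρ * q - p| = Q * Δ := by
      have h1 : ρ * (q : ℝ) - p = Q * (ρ - r) := by rw [hrpq, hQdef]; field_simp
      rw [h1, abs_mul, abs_of_pos hQ0, hΔdef]
    -- THE ROOT PACKAGES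
    obtain ⟨hA0, hdegA, y, hyA, hyK⟩ := root_package GA hKA hGAK hDA hrelA hΛA r hdenA hΔ1'
    obtain ⟨hB0, hdegB, γ, hγB, hγK⟩ := root_package GB hKB hGBK hDB hrelB hΛB r hdenB hΔ1'
    obtain ⟨hlcA, hrootsA⟩ := root_bounds GA hDA r.num r.den hA0 hdegA
    obtain ⟨hlcB, hrootsB⟩ := root_bounds GB hDB r.num r.den hB0 hdegB
    rw [habsnum] at hlcA hrootsA hlcB hrootsB
    rw [← hΔdef] at hyK hγK
    set A := specY GA DA r.num r.den with hAdef
    set B := specY GB DB r.num r.den with hBdef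
    -- sizes
    have hcast : ((q : ℕ) : ℝ) = Q := hQdef.symm
    rw [hcast] at hlcA hrootsA hlcB hrootsB hyK hγK
    have hMA : relLen GA * ((p : ℝ) + Q) ^ DA ≤ Q ^ (2 * DA + 1) :=
      budget_M hQ0.le (by linarith) hLAQ (by positivity) hpQQ
    have hMB : relLen GB * ((p : ℝ) + Q) ^ DB ≤ Q ^ (2 * DB + 1) :=
      budget_M hQ0.le (by linarith) hLBQ (by positivity) hpQQ
    have hMA0 : 0 ≤ relLen GA * ((p : ℝ) + Q) ^ DA := by positivity
    have hMB0 : 0 ≤ relLen GB * ((p : ℝ) + Q) ^ DB := by positivity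
    have hMA1 : 1 ≤ relLen GA * ((p : ℝ) + Q) ^ DA :=
      one_le_mul_of_one_le_of_one_le hLA1 (one_le_pow₀ (by linarith [Nat.cast_nonneg (α := ℝ) p]))
    -- the common root bound R
    obtain ⟨R, hRdef⟩ : ∃ R : ℝ, R = ((KA : ℝ) + 1) * (relLen GA * ((p : ℝ) + Q) ^ DA) +
        ((KB : ℝ) + 1) * (relLen GB * ((p : ℝ) + Q) ^ DB) := ⟨_, rfl⟩
    have hR1 : 1 ≤ R := by
      rw [hRdef]
      have h1 : (1 : ℝ) ≤ ((KA : ℝ) + 1) * (relLen GA * ((p : ℝ) + Q) ^ DA) :=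
        one_le_mul_of_one_le_of_one_le (by linarith [Nat.cast_nonneg (α := ℝ) KA]) hMA1
      have h2 : (0 : ℝ) ≤ ((KB : ℝ) + 1) * (relLen GB * ((p : ℝ) + Q) ^ DB) := by positivity
      linarith
    have hRA : ∀ z ∈ A.aroots ℂ, ‖z‖ ≤ R := fun z hz => by
      rw [hRdef]; exact (hrootsA z hz).trans (le_add_of_nonneg_right (by positivity))
    have hRB : ∀ z ∈ B.aroots ℂ, ‖z‖ ≤ R := fun z hz => by
      rw [hRdef]; exact (hrootsB z hz).trans (le_add_of_nonneg_left (by positivity))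
    have hKAQ : (KA : ℝ) + 1 ≤ Q := by rw [hQdef]; exact_mod_cast hKAq
    have hKBQ : (KB : ℝ) + 1 ≤ Q := by rw [hQdef]; exact_mod_cast hKBq
    have hRE : R ≤ Q ^ E := by rw [hRdef]; exact budget_R hQ2 hMA0 hMB0 hMA hMB hKAQ hKBQ hE
    -- leading coefficients
    have hE1 : Q ^ (2 * DA + 1) ≤ Q ^ E := pow_le_pow_right₀ hQ1 (by rw [hE]; omega)
    have hE2 : Q ^ (2 * DB + 1) ≤ Q ^ E := pow_le_pow_right₀ hQ1 (by rw [hE]; omega)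
    have hlcAE : ((A.leadingCoeff.natAbs : ℕ) : ℝ) ≤ Q ^ E := hlcA.trans (hMA.trans hE1)
    have hlcBE : ((B.leadingCoeff.natAbs : ℕ) : ℝ) ≤ Q ^ E := hlcB.trans (hMB.trans hE2)
    have hlcA1 : 1 ≤ A.leadingCoeff.natAbs :=
      Nat.one_le_iff_ne_zero.mpr (Int.natAbs_ne_zero.mpr (leadingCoeff_ne_zero.mpr hA0))
    have hlcB1 : 1 ≤ B.leadingCoeff.natAbs :=
      Nat.one_le_iff_ne_zero.mpr (Int.natAbs_ne_zero.mpr (leadingCoeff_ne_zero.mpr hB0))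
    -- (c1) |lc A|^{κ} < 2^q and (c2) R^κ < (1+η)^q
    have hc1 : A.leadingCoeff.natAbs ^ (KA * KB) < 2 ^ q := by
      have h : ((A.leadingCoeff.natAbs : ℕ) : ℝ) ^ (KA * KB) < (2 : ℝ) ^ q := by
        calc ((A.leadingCoeff.natAbs : ℕ) : ℝ) ^ (KA * KB) ≤ (Q ^ E) ^ (KA * KB) :=
              pow_le_pow_left₀ (Nat.cast_nonneg _) hlcAE _
          _ = Q ^ (E * κ) := by rw [hκdef, ← pow_mul]
          _ < 2 ^ q := by rw [hQdef]; exact hq₂ q hq₂q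
      exact_mod_cast h
    have hc2 : R ^ (KA * KB) < (1 + η) ^ q := by
      calc R ^ (KA * KB) ≤ (Q ^ E) ^ (KA * KB) := pow_le_pow_left₀ (by linarith) hRE _
        _ = Q ^ (E * κ) := by rw [hκdef, ← pow_mul]
        _ < (1 + η) ^ q := by rw [hQdef]; exact hq₃ q hq₃q
    -- root closeness: δ_A, δ_B < θ
    have hδA : ‖cexp u - y‖ < θ := budget_close hQ1 hΔpos hΔΨ hθdef hKA (Nat.le_add_right KA KB)
      hDAE hΛAQ hΨ hqpos (norm_nonneg _) hyK
    have hδB : ‖cexp (u * ρ) - γ‖ < θ := budget_close hQ1 hΔpos hΔΨ hθdef hKB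
      (Nat.le_add_left KB KA) hDBE hΛBQ hΨ hqpos (norm_nonneg _) hγK
    have hy0 : y ≠ 0 := by
      intro h; rw [h, sub_zero] at hδA; exact absurd (hδA.trans hθw) (lt_irrefl _)
    have hγ0 : γ ≠ 0 := by
      intro h; rw [h, sub_zero] at hδB; exact absurd (hδB.trans hθw') (lt_irrefl _)
    -- the Kummer closeness estimate
    have hsmall : ‖u‖ * |ρ * q - p| ≤ 1 := by
      rw [hρqp]
      exact budget_small hQ1 (norm_nonneg u) huQ' hΔpos.le hΔΨ
        (le_trans hΨ2 (Nat.le_mul_of_pos_right Ψ hqpos))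
    have hclose := kummer_closeness u ρ hδA.le hδB.le hθ1 hθ1 hsmall
    rw [hρqp] at hclose
    have hsum : ‖γ ^ q - y ^ p‖ ≤ 3 * (Q ^ ((c₀ + 2) * q) * θ) :=
      hclose.trans (budget_T hQdef hQ1 hθpos hΔθ.le hΔpos.le (norm_nonneg _) (norm_nonneg _)
        (norm_nonneg u) hwQ hw'Q hexpQ huQ hc₀Q hc₀2 hp_c₀q hqpos)
    -- the exactness threshold
    have hc_le : (((A.leadingCoeff * B.leadingCoeff).natAbs : ℕ) : ℝ) ≤ Q ^ E * Q ^ E := by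
      rw [Int.natAbs_mul, Nat.cast_mul]
      exact mul_le_mul hlcAE hlcBE (Nat.cast_nonneg _) (by positivity)
    have hc_ge : (1 : ℝ) ≤ (((A.leadingCoeff * B.leadingCoeff).natAbs : ℕ) : ℝ) := by
      rw [Int.natAbs_mul, Nat.cast_mul]
      exact one_le_mul_of_one_le_of_one_le (by exact_mod_cast hlcA1) (by exact_mod_cast hlcB1)
    have hΘ : (2 * ((((A.leadingCoeff * B.leadingCoeff).natAbs : ℕ) : ℝ) * R) ^ (p + q)) ^ (KA * KB)
        ≤ Q ^ (Φ₁ * q) := by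
      rw [← hκdef]
      exact budget_Theta hQ2 hc_ge hc_le hR1 hRE hpq_nat (by omega) (by omega) hqpos hΦ₁
    have hfinal : ‖γ ^ q - y ^ p‖ <
        ((2 * ((((A.leadingCoeff * B.leadingCoeff).natAbs : ℕ) : ℝ) * R) ^ (p + q)) ^ (KA * KB))⁻¹ := by
      have hpos : (0 : ℝ) < (2 * ((((A.leadingCoeff * B.leadingCoeff).natAbs : ℕ) : ℝ) * R) ^
          (p + q)) ^ (KA * KB) := by positivity
      refine lt_of_lt_of_le ?_ (inv_anti₀ hpos hΘ)
      refine lt_of_le_of_lt hsum ?_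
      rw [hθdef]
      exact budget_final hQ3 hq2 hΦ
    -- Kummer torsion
    have hT := hKT A B hA0 hB0 hdegA.le hdegB.le R hR1 hRA hRB y γ hy0 hγ0 hyA hγB p q hqpos hcop
      hc1 hc2 hfinal
    exact ⟨y, γ, hT.1, hT.2, hδA.trans hθε, hδB.trans hθε⟩
  -- ENDGAME
  refine cf_torsion_endgame_irr hu0 (hρ.irrational le_rfl) hN (fun ε hε => ?_) (fun ε hε => ?_)
  · obtain ⟨y, γ, hy, -, hyε, -⟩ := claim ε hε
    exact ⟨y, hy, hyε⟩
  · obtain ⟨y, γ, -, hγ, -, hγε⟩ := claim ε hε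
    exact ⟨γ, hγ, hγε⟩

/-- **Piece CF at order 3**, unfolded form. -/
theorem cylinderFunnel_ord (u : ℂ) (ρ : ℝ) (hu0 : u ≠ 0) (hρ : LiouvilleOrder 3 ρ) (hρ0 : 0 < ρ) :
    AlgebraicIndependent ℚ ![(ρ : ℂ), cexp u] ∨ AlgebraicIndependent ℚ ![(ρ : ℂ), cexp (u * ρ)] := by
  by_contra h
  rw [not_or] at h
  exact cylinderFunnel_false_ord hu0 hρ hρ0 h.1 h.2

end Summit.Schanuel.Schanuel.Theorems.RootDecomp1KGeneric
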